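import Mathlib.AlgebraicGeometry.ZariskisMainTheorem
import Mathlib.AlgebraicGeometry.Morphisms.FormallyUnramified
import Mathlib.AlgebraicGeometry.Morphisms.UniversallyInjective
import Mathlib.FieldTheory.IsAlgClosed.AlgebraicClosure
import HarnessLib

/-!
# A proper unramified morphism injective on geometric points is a closed immersion
# (EGA IV₄ 17.2.6 / 18.12.6; Stacks Project Tags 01S4, 04XV)

Layer `Literature/AlgebraicGeometry/Morphisms`, namespace `Literature.AlgebraicGeometry.Morphisms`.  THEOREMS ONLY (no definition, no named
fact, no instance, no notation, no `sorry`); Mathlib-only imports.  Cell `hodgecm-mathlib` (D-0151), F-3 (M) grandchild line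
`Cruxes/HDel/Lines/F3DualAbelianSchemeMc` (B-p02 (g16) skeleton v0 ef3c28a3), generic brick **W1** = its `socket_McW1` :217 (pen ruling B-plan1 (g19)
2026-08-30 20:03:53Z; author B-p03 (g20)): the ALL-GEOMETRIC-POINTS form (currency D2: the base need not be Jacobson) of the tree's ℂ-point
statement ★ `Morphisms/ClosedImmersionOfUnramifiedInjective.isClosedImmersion_left_of_isProper_of_formallyUnramified_of_injective_complexPoints`
(which reads injectivity off the closed points of a Jacobson space); universe-polymorphic, over an arbitrary base scheme.
HC_CM is proved only modulo the 7 printed citations until rung 0 closes; nothing here is about HC.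

For a morphism of schemes `f : X ⟶ Y` call `f` INJECTIVE ON GEOMETRIC POINTS if for every algebraically closed field `Ω` the map
`X(Ω) → Y(Ω)`, `x ↦ x ≫ f`, is injective.

* `surjective_diagonal_of_injective_geometricPoints` — then the diagonal `Δ_f : X → X ×_Y X` is SURJECTIVE: a point `z` of `X ×_Y X` is hit
  by the geometric point `Spec Ω̄(z) → Spec κ(z) → X ×_Y X` (`Ω̄(z)` an algebraic closure of the residue field), whose two projections are
  geometric points of `X` with the same image in `Y`, hence equal, so the geometric point factors through `Δ_f` ([StacksProject, 01S4 (4)]);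
* `universallyInjective_of_injective_geometricPoints` — equivalently `f` is UNIVERSALLY INJECTIVE (Mathlib `UniversallyInjective.iff_diagonal`;
  [StacksProject, 01S4], [EGAIV4, 17.2.6]'s «radiciel»);
* `mono_of_formallyUnramified_of_injective_geometricPoints` — if moreover `f` is UNRAMIFIED (formally unramified and locally of finite type),
  `Δ_f` is an open immersion (Mathlib `isOpenImmersion_diagonal`) and surjective, hence an isomorphism: `f` is a MONOMORPHISM
  ([EGAIV4, Prop. 17.2.6]: monomorphisme ⟺ radiciel et non ramifié);
* **`isClosedImmersion_of_isProper_of_formallyUnramified_of_injective_geometricPoints`** — if moreover `f` is PROPER, `f` is a CLOSED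
  IMMERSION (proper monomorphism; Mathlib `IsClosedImmersion.iff_isProper_and_mono`, [EGAIV4, Cor. 18.12.6], [StacksProject, 04XV]).

## References
* [EGAIV4] A. Grothendieck, J. Dieudonné, *EGA IV₄* (Publ. Math. IHÉS 32, 1967), Prop. 17.2.6, Cor. 18.12.6.
* [StacksProject] The Stacks Project, Tag 01S4 (universally injective ⟺ diagonal surjective), Tag 04XV (closed immersion ⟺ proper
  monomorphism ⟺ proper, unramified and universally injective).
-/

set_option autoImplicit false

noncomputable section

universe u

open CategoryTheory CategoryTheory.Limits AlgebraicGeometry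

namespace Literature.AlgebraicGeometry.Morphisms

variable {X Y : Scheme.{u}} (f : X ⟶ Y)

/-- **Injective on geometric points ⇒ the diagonal is surjective**: every point `z ∈ X ×_Y X` is the image of the geometric point
`Spec Ω̄(z) → X ×_Y X` (through an algebraic closure of `κ(z)`), whose two projections to `X` agree after `f`, hence agree, so the geometric
point factors through `Δ_f`. [cite: StacksProject, Tag 01S4] [cite: EGAIV4, Prop. 17.2.6] -/
theorem surjective_diagonal_of_injective_geometricPoints
    (hinj : ∀ (Ω : Type u) [Field Ω] [IsAlgClosed Ω] (x₁ x₂ : Spec (.of Ω) ⟶ X), x₁ ≫ f = x₂ ≫ f → x₁ = x₂) :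
    Surjective (pullback.diagonal f) := by
  rw [surjective_iff]
  intro z
  let Ω : Type u := AlgebraicClosure ((pullback f f).residueField z)
  obtain ⟨φ, hφ⟩ : ∃ φ : Spec (.of Ω) ⟶ pullback f f,
      φ = Spec.map (CommRingCat.ofHom (algebraMap ((pullback f f).residueField z) Ω)) ≫ (pullback f f).fromSpecResidueField z :=
    ⟨_, rfl⟩
  have hφ₁ : φ ≫ pullback.fst f f = φ ≫ pullback.snd f f :=
    hinj Ω (φ ≫ pullback.fst f f) (φ ≫ pullback.snd f f) (by simp only [Category.assoc, pullback.condition])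
  have hφ₂ : φ = (φ ≫ pullback.fst f f) ≫ pullback.diagonal f := by
    apply pullback.hom_ext
    · simp only [Category.assoc, pullback.diagonal_fst, Category.comp_id]
    · simp only [Category.assoc, pullback.diagonal_snd, Category.comp_id, hφ₁]
  refine ⟨(φ ≫ pullback.fst f f) (IsLocalRing.closedPoint Ω), ?_⟩
  rw [← Scheme.Hom.comp_apply, ← hφ₂, hφ, Scheme.Hom.comp_apply, Scheme.fromSpecResidueField_apply]

/-- **Injective on geometric points ⇒ universally injective** (Mathlib `UniversallyInjective.iff_diagonal`; [EGAIV4] 17.2.6's «radiciel»).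
[cite: StacksProject, Tag 01S4] [cite: EGAIV4, Prop. 17.2.6] -/
theorem universallyInjective_of_injective_geometricPoints
    (hinj : ∀ (Ω : Type u) [Field Ω] [IsAlgClosed Ω] (x₁ x₂ : Spec (.of Ω) ⟶ X), x₁ ≫ f = x₂ ≫ f → x₁ = x₂) :
    UniversallyInjective f :=
  (UniversallyInjective.iff_diagonal f).mpr (surjective_diagonal_of_injective_geometricPoints f hinj)

/-- **An unramified morphism injective on geometric points is a monomorphism** ([EGAIV4] Prop. 17.2.6: «monomorphisme ⟺ radiciel et non
ramifié»): the diagonal of an unramified morphism is an open immersion (Mathlib `isOpenImmersion_diagonal`) and it is surjective, hence an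
isomorphism. [cite: EGAIV4, Prop. 17.2.6] [cite: StacksProject, Tag 04XV] -/
theorem mono_of_formallyUnramified_of_injective_geometricPoints [FormallyUnramified f] [LocallyOfFiniteType f]
    (hinj : ∀ (Ω : Type u) [Field Ω] [IsAlgClosed Ω] (x₁ x₂ : Spec (.of Ω) ⟶ X), x₁ ≫ f = x₂ ≫ f → x₁ = x₂) : Mono f := by
  haveI : Surjective (pullback.diagonal f) := surjective_diagonal_of_injective_geometricPoints f hinj
  haveI : Epi (pullback.diagonal f).base := (TopCat.epi_iff_surjective _).mpr (pullback.diagonal f).surjective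
  haveI : IsIso (pullback.diagonal f) := IsOpenImmersion.isIso _
  exact (pullback.isIso_diagonal_iff f).mp inferInstance

/-- **W1 — A PROPER UNRAMIFIED MORPHISM INJECTIVE ON GEOMETRIC POINTS IS A CLOSED IMMERSION** (a proper monomorphism is a closed immersion:
[EGAIV4] Cor. 18.12.6, [StacksProject] 04XV, Mathlib `IsClosedImmersion.iff_isProper_and_mono`; `IsProper f` supplies `LocallyOfFiniteType f`).
The letter of `socket_McW1` of the (Mc) grandchild skeleton, universe-polymorphic. [cite: EGAIV4, Cor. 18.12.6] [cite: StacksProject, Tag 04XV] -/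
theorem isClosedImmersion_of_isProper_of_formallyUnramified_of_injective_geometricPoints [FormallyUnramified f] [IsProper f]
    (hinj : ∀ (Ω : Type u) [Field Ω] [IsAlgClosed Ω] (x₁ x₂ : Spec (.of Ω) ⟶ X), x₁ ≫ f = x₂ ≫ f → x₁ = x₂) :
    IsClosedImmersion f :=
  (IsClosedImmersion.iff_isProper_and_mono f).mpr ⟨inferInstance, mono_of_formallyUnramified_of_injective_geometricPoints f hinj⟩

/-- The socket shape of the (Mc) skeleton (`∀ {X Y} f [FormallyUnramified f] [IsProper f], … → IsClosedImmersion f`, universe `0` being the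
instance used there), for by-name consumption. [cite: EGAIV4, Cor. 18.12.6] [cite: StacksProject, Tag 04XV] -/
theorem isClosedImmersion_of_forall_injective_geometricPoints :
    ∀ {X Y : Scheme.{u}} (f : X ⟶ Y) [FormallyUnramified f] [IsProper f],
      (∀ (Ω : Type u) [Field Ω] [IsAlgClosed Ω] (x₁ x₂ : Spec (.of Ω) ⟶ X), x₁ ≫ f = x₂ ≫ f → x₁ = x₂) →
      IsClosedImmersion f :=
  fun f _ _ hinj => isClosedImmersion_of_isProper_of_formallyUnramified_of_injective_geometricPoints f hinj

end Literature.AlgebraicGeometry.Morphisms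

end
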